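import Summits.NavierStokesRegularity.NavierStokesRegularity.Theorems.ExtremiserTransienceMultiscaleCrowdingLiouville
import Summits.NavierStokesRegularity.NavierStokesRegularity.Theorems.ExtremiserTransienceNearExtremalTransiencePerFlowOfFilamentSelectionAllTime
import Summits.NavierStokesRegularity.NavierStokesRegularity.Theorems.ExtremiserTransienceNearExtremalTransiencePerFlowStubUbiquityToLimit
import HarnessLib

/-!
# LINE g10-γ «multiscale crowding» (crux 26567): the crux from the heart T♭ ALONE, by name in the tree

Helper file for the crux `NearExtremalTransiencePerFlow` (stmt-NavierStokesRegularity-26567), LINE g10-γ `multiscale_crowding` (skeleton of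
record 1c5b3d804149, planner ns-idea-5 g10; `E3` spelled out).  With L1ᵘ (p706162), L2 (p704994), L3ᵐˢ and the local crowding Liouville
theorem (`localCrowdingLiouville`, sibling file) all theorems of the tree, the registered skeleton's composition needs only its heart:

* `nearExtremalTransiencePerFlow_of_tightOrCrowding : TightOrCrowding → NearExtremalTransiencePerFlow` (the skeleton theorem of the workfile
  with the two analytic hypotheses discharged; proof verbatim otherwise);
* `tightOrCrowding_of_members : TightOrCrowdingMembers → TightOrCrowding` (the author's kernel-checked limit passage, with
  `norm_sub_le_of_iteratedFDeriv_one_le`, `separated_points_of_limit`) and hence `nearExtremalTransiencePerFlow_of_tightOrCrowdingMembers`.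

HONEST FRAMING: conditional on the OPEN heart T♭ `TightOrCrowding`; nothing about Navier–Stokes regularity or blow-up is proved; no summit is
proved by a line. [folklore]
-/

noncomputable section

open scoped Topology InnerProductSpace RealInnerProductSpace ENNReal ContDiff
open MeasureTheory Filter Set Metric Function
open Literature.Analysis Literature.Analysis.FluidPDE
open Summit.NavierStokesRegularity.NavierStokesRegularity.Theses.ExtremiserTransience
open Summit.NavierStokesRegularity.NavierStokesRegularity.Theorems
open Summit.NavierStokesRegularity.NavierStokesRegularity.Theorems.NearExtremalTransiencePerFlow
open Summit.NavierStokesRegularity.NavierStokesRegularity.Theorems.NearExtremalTransiencePerFlow.ZoneTransversality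
open Summit.NavierStokesRegularity.NavierStokesRegularity.Theorems.NearExtremalTransiencePerFlow.MemberSelection
open Summit.NavierStokesRegularity.NavierStokesRegularity.Theorems.NearExtremalTransiencePerFlow.DissipationLedger
  (HasLinGrowthAllTime dissMeasure ViolatorDissipation stub_uniformDissipationBudget stub_violatorDissipation
    norm_sub_le_of_iteratedFDeriv_one_le)
open Summit.NavierStokesRegularity.NavierStokesRegularity.Theorems.NearExtremalTransiencePerFlow.TightOrChain
  (UniformDissipationBudget ChainUpTo ChainsOfEveryLength)

namespace Summit.NavierStokesRegularity.NavierStokesRegularity.Theorems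

set_option linter.dupNamespace false

namespace NearExtremalTransiencePerFlow.MultiscaleCrowding

/-! ### T♭ at member level ⇒ T♭ (limit passage) -/

/-- **Finite separated level sets pass to the limit** (Bolzano–Weierstrass in `Fin N → ℝ³` + equi-Lipschitz): if eventually every member
`v n` has `N` points in `B̄(y n, L)` at level `≥ η`, pairwise `≥ ℓ > 0` apart, then the pointwise limit `w` of the translates `v n (y n + ·)`
has `N` such points in `B̄(0, L)` (same level, same separation). -/
theorem separated_points_of_limit (v : ℕ → (EuclideanSpace ℝ (Fin 3)) → (EuclideanSpace ℝ (Fin 3))) (Λ₁ L ℓ η : ℝ) (y : ℕ → (EuclideanSpace ℝ (Fin 3))) (w : (EuclideanSpace ℝ (Fin 3)) → (EuclideanSpace ℝ (Fin 3))) (N : ℕ)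
    (hcd : ∀ n, ContDiff ℝ (⊤ : ℕ∞) (v n)) (hΛ : ∀ n (x : (EuclideanSpace ℝ (Fin 3))), ‖iteratedFDeriv ℝ 1 (v n) x‖ ≤ Λ₁) (hℓ : 0 < ℓ)
    (hS : ∀ᶠ n in atTop, ∃ S : Finset (EuclideanSpace ℝ (Fin 3)), N ≤ S.card ∧ (∀ z ∈ S, ‖z - y n‖ ≤ L ∧ η ≤ ‖v n z‖) ∧
      (∀ z ∈ S, ∀ z' ∈ S, z ≠ z' → ℓ ≤ ‖z - z'‖))
    (hconv : ∀ z : (EuclideanSpace ℝ (Fin 3)), Tendsto (fun n => v n (y n + z)) atTop (𝓝 (w z))) :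
    ∃ S : Finset (EuclideanSpace ℝ (Fin 3)), S.card = N ∧ (∀ z ∈ S, ‖z‖ ≤ L ∧ η ≤ ‖w z‖) ∧
      (∀ z ∈ S, ∀ z' ∈ S, z ≠ z' → ℓ ≤ ‖z - z'‖) := by
  rcases Nat.eq_zero_or_pos N with hN | hN
  · exact ⟨∅, by simp [hN], by simp, by simp⟩
  obtain ⟨φ₀, hφ₀, hP⟩ := extraction_of_eventually_atTop hS
  choose S hS using hP
  -- sub-finsets of exact cardinality `N`, enumerated by `Fin N`
  have ht : ∀ n, ∃ t : Finset (EuclideanSpace ℝ (Fin 3)), t ⊆ S n ∧ t.card = N := fun n => Finset.exists_subset_card_eq (hS n).1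
  choose t htS htc using ht
  obtain ⟨p, hp⟩ : ∃ p : ℕ → Fin N → (EuclideanSpace ℝ (Fin 3)), ∀ n i, p n i = ((t n).equivFin.symm (Fin.cast (htc n).symm i) : (EuclideanSpace ℝ (Fin 3))) :=
    ⟨_, fun _ _ => rfl⟩
  have hpmem : ∀ n i, p n i ∈ S n := fun n i => by rw [hp]; exact htS n (Subtype.coe_prop _)
  have hpinj : ∀ n i i', i ≠ i' → p n i ≠ p n i' := by
    intro n i i' hii' h
    rw [hp, hp] at h
    have h1 := (t n).equivFin.symm.injective (Subtype.ext h)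
    exact hii' (Fin.cast_injective _ h1)
  -- `L ≥ 0` (there is a point), and the relative positions live in a compact set of `Fin N → ℝ³`
  have hL : 0 ≤ L := by
    have h := ((hS 0).2.1 (p 0 ⟨0, hN⟩) (hpmem 0 _)).1
    exact (norm_nonneg _).trans h
  obtain ⟨x, hx⟩ : ∃ x : ℕ → Fin N → (EuclideanSpace ℝ (Fin 3)), ∀ n i, x n i = p n i - y (φ₀ n) := ⟨_, fun _ _ => rfl⟩
  have hxmem : ∀ n, x n ∈ Metric.closedBall (0 : Fin N → (EuclideanSpace ℝ (Fin 3))) L := by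
    intro n
    rw [Metric.mem_closedBall, dist_zero_right, pi_norm_le_iff_of_nonneg hL]
    intro i
    rw [hx]; exact ((hS n).2.1 (p n i) (hpmem n i)).1
  obtain ⟨a, ha, ψ, hψ, hxa⟩ := (isCompact_closedBall (0 : Fin N → (EuclideanSpace ℝ (Fin 3))) L).tendsto_subseq hxmem
  have hxi : ∀ i, Tendsto (fun n => x (ψ n) i) atTop (𝓝 (a i)) := fun i => tendsto_pi_nhds.1 hxa i
  -- each limit position: in the ball, at level `≥ η`
  have hai_norm : ∀ i, ‖a i‖ ≤ L := fun i => by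
    have h := ha; rw [Metric.mem_closedBall, dist_zero_right] at h
    exact (norm_le_pi_norm a i).trans h
  have hai_lev : ∀ i, η ≤ ‖w (a i)‖ := by
    intro i
    have hconv' : Tendsto (fun n => ‖v (φ₀ (ψ n)) (y (φ₀ (ψ n)) + a i)‖) atTop (𝓝 ‖w (a i)‖) :=
      ((hconv (a i)).comp ((hφ₀.comp hψ).tendsto_atTop)).norm
    have hlow : Tendsto (fun n => η - Λ₁ * ‖a i - x (ψ n) i‖) atTop (𝓝 η) := by
      have h1 : Tendsto (fun n => a i - x (ψ n) i) atTop (𝓝 (a i - a i)) := tendsto_const_nhds.sub (hxi i)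
      rw [sub_self] at h1
      have h2 : Tendsto (fun n => ‖a i - x (ψ n) i‖) atTop (𝓝 0) := by simpa using h1.norm
      have h3 : Tendsto (fun n => η - Λ₁ * ‖a i - x (ψ n) i‖) atTop (𝓝 (η - Λ₁ * 0)) :=
        tendsto_const_nhds.sub (tendsto_const_nhds.mul h2)
      simpa using h3
    have hle : ∀ n, η - Λ₁ * ‖a i - x (ψ n) i‖ ≤ ‖v (φ₀ (ψ n)) (y (φ₀ (ψ n)) + a i)‖ := by
      intro n
      have hlip := norm_sub_le_of_iteratedFDeriv_one_le (hcd (φ₀ (ψ n))) (hΛ (φ₀ (ψ n)))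
        (y (φ₀ (ψ n)) + a i) (p (ψ n) i)
      have e1 : y (φ₀ (ψ n)) + a i - p (ψ n) i = a i - x (ψ n) i := by rw [hx]; abel
      rw [e1] at hlip
      have hη := ((hS (ψ n)).2.1 (p (ψ n) i) (hpmem (ψ n) i)).2
      have htri : ‖v (φ₀ (ψ n)) (p (ψ n) i)‖ - ‖v (φ₀ (ψ n)) (y (φ₀ (ψ n)) + a i) - v (φ₀ (ψ n)) (p (ψ n) i)‖ ≤
          ‖v (φ₀ (ψ n)) (y (φ₀ (ψ n)) + a i)‖ := by
        have := norm_sub_norm_le (v (φ₀ (ψ n)) (p (ψ n) i)) (v (φ₀ (ψ n)) (y (φ₀ (ψ n)) + a i))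
        rw [norm_sub_rev] at this
        linarith
      linarith
    exact le_of_tendsto_of_tendsto' hlow hconv' hle
  -- pairwise separation of the limit positions
  have hsep : ∀ i i', i ≠ i' → ℓ ≤ ‖a i - a i'‖ := by
    intro i i' hii'
    have h1 : Tendsto (fun n => ‖x (ψ n) i - x (ψ n) i'‖) atTop (𝓝 ‖a i - a i'‖) := ((hxi i).sub (hxi i')).norm
    refine ge_of_tendsto' h1 fun n => ?_
    have e : x (ψ n) i - x (ψ n) i' = p (ψ n) i - p (ψ n) i' := by rw [hx, hx]; abel
    rw [e]
    exact (hS (ψ n)).2.2 _ (hpmem _ _) _ (hpmem _ _) (hpinj _ i i' hii')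
  have hainj : Function.Injective a := by
    intro i i' h
    by_contra hii'
    have h1 := hsep i i' hii'
    rw [h, sub_self, norm_zero] at h1
    linarith
  refine ⟨Finset.univ.image a, ?_, ?_, ?_⟩
  · rw [Finset.card_image_of_injective _ hainj, Finset.card_univ, Fintype.card_fin]
  · intro z hz
    obtain ⟨i, -, rfl⟩ := Finset.mem_image.1 hz
    exact ⟨hai_norm i, hai_lev i⟩
  · intro z hz z' hz' hzz
    obtain ⟨i, -, rfl⟩ := Finset.mem_image.1 hz
    obtain ⟨i', -, rfl⟩ := Finset.mem_image.1 hz'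
    exact hsep i i' fun h => hzz (by rw [h])

/-- **Kernel-checked reduction T♭ ⇐ T♭ₘₑₘ**: the limit passage of the crowding branch, scale by scale, by `separated_points_of_limit`
(with the family's uniform gradient bound `Λ 1`); the limit configuration sits about the origin of the moving frame. -/
theorem tightOrCrowding_of_members (h : TightOrCrowdingMembers) : TightOrCrowding := by
  intro v Λ Θ ε A hfam hgr
  obtain ⟨y, φ, W₀, hφ, hconv, hdich⟩ := h v Λ Θ ε A hfam hgr
  refine ⟨y, φ, W₀, hφ, hconv, ?_⟩
  rcases hdich with hext | ⟨C, η, hC, hη, hcrowd⟩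
  · exact Or.inl hext
  · right
    refine ⟨C, η, hC, hη, fun m ℓ₀ hℓ₀ => ?_⟩
    obtain ⟨L, k, hk, hkL, hconf⟩ := hcrowd m ℓ₀ hℓ₀
    refine ⟨0, L, k, hk, hkL, fun j hj => ?_⟩
    have hcd : ∀ n, ContDiff ℝ (⊤ : ℕ∞) (v (φ n)) := fun n => hfam.1 (φ n)
    have hΛ : ∀ n (x : (EuclideanSpace ℝ (Fin 3))), ‖iteratedFDeriv ℝ 1 (v (φ n)) x‖ ≤ Λ 1 := fun n x => hfam.2.2.2.1 1 (φ n) x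
    have hℓ : 0 < ℓ₀ * 6 ^ (k j) := by positivity
    -- the required number of points, as a natural number
    obtain ⟨N, hN⟩ : ∃ N : ℕ, N = ⌈C * L / (ℓ₀ * 6 ^ (k j))⌉₊ := ⟨_, rfl⟩
    have hSN : ∀ᶠ n in atTop, ∃ S : Finset (EuclideanSpace ℝ (Fin 3)), N ≤ S.card ∧ (∀ z ∈ S, ‖z - y (φ n)‖ ≤ L ∧ η ≤ ‖v (φ n) z‖) ∧
        (∀ z ∈ S, ∀ z' ∈ S, z ≠ z' → ℓ₀ * 6 ^ (k j) ≤ ‖z - z'‖) := by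
      filter_upwards [hconf j hj] with n ⟨S, hcard, hmem, hsep⟩
      exact ⟨S, by rw [hN]; exact Nat.ceil_le.2 hcard, hmem, hsep⟩
    obtain ⟨S, hScard, hSmem, hSsep⟩ := separated_points_of_limit (fun n => v (φ n)) (Λ 1) L (ℓ₀ * 6 ^ (k j)) η
      (fun n => y (φ n)) W₀ N hcd hΛ hℓ hSN hconv
    refine ⟨S, ?_, fun z hz => ⟨by simpa using (hSmem z hz).1, (hSmem z hz).2⟩, hSsep⟩
    rw [hScard, hN]; exact Nat.le_ceil _

/-! ### The crux from T♭ alone -/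

/-- **The crux `NearExtremalTransiencePerFlow` from the heart T♭ `TightOrCrowding` ALONE** (the skeleton theorem of LINE g10-γ with its two
analytic hypotheses L1ᵘ, L2 discharged by the landed `DissipationLedger.stub_uniformDissipationBudget` / `….stub_violatorDissipation`; proof
otherwise verbatim, planner ns-idea-5 g10).  Violator frame by
contradiction → F1 budget `A` (`flowFilamentBudget`) → T0 data (`efficientTimesNoDust_holds`) → T2′ zoom family + flow compactness
(`zoomPackageFlow`) → eventual growth of the members (`ballEnergy_zoom_le`) → T♭: centres, subsequence, limit `W₀`, dichotomy → flow
compactness at those centres: `W₀ = W s`, `W` Type-I ancient mild → G′ (`growthTransferFlow`): all-time growth → tight branch: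
`not_isExtremalSlice_of_typeIAncientMild`; crowding branch: `LocalCrowdingLiouville` at `(m, ℓ₀)(K, A, C, η, s)`. -/
theorem nearExtremalTransiencePerFlow_of_tightOrCrowding (hT : TightOrCrowding) : NearExtremalTransiencePerFlow := by
  have hL : LocalCrowdingLiouville := localCrowdingLiouville
  have hT0 : EfficientTimesNoDust := efficientTimesNoDust_holds
  intro C ν T hC hν hT' u p hsol hLH hdec hrate hsing
  by_contra hno
  have hV : IsViolator C ν T u p := ⟨hC, hν, hT', hsol, hLH, hdec, hrate, hsing, hno⟩
  obtain ⟨A, hA⟩ := FilamentGap.flowFilamentBudget C ν T hC hν hT' u p hsol hLH hdec hrate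
  obtain ⟨Θ, t, Mb, ε, hdata⟩ := hT0 C ν T u p hV
  obtain ⟨σ, Λ, Θ', ε', hσ, hfam, hcompF⟩ := FilamentSelection.zoomPackageFlow C ν T u p hV Θ t Mb ε hdata
  set V : ℕ → (EuclideanSpace ℝ (Fin 3)) → (EuclideanSpace ℝ (Fin 3)) := fun n z => (Mb (σ n))⁻¹ • u (t (σ n)) ((ν / Mb (σ n)) • z) with hVdef
  have htT : Tendsto (fun n => t (σ n)) atTop (𝓝[<] T) := by
    have h1 : Tendsto (fun n => t (σ n)) atTop (𝓝 T) := hdata.2.1.comp hσ.tendsto_atTop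
    exact tendsto_nhdsWithin_iff.2 ⟨h1, Eventually.of_forall fun n => (hdata.1 (σ n)).2⟩
  have hgrV : ∀ᶠ n in atTop, ∀ (x : (EuclideanSpace ℝ (Fin 3))) (R : ℝ), 0 < R → ∫ z in Metric.ball x R, ‖V n z‖ ^ 2 ≤ A * R := by
    filter_upwards [htT.eventually hA] with n hn x R hR
    have h := FilamentSelection.ballEnergy_zoom_le hν (hdata.2.2.2.1 (σ n)) hn 0 x hR
    simpa only [zero_add] using h
  obtain ⟨y, φ, W₀, hφ, hconv, hdich⟩ := hT V Λ Θ' ε' A hfam hgrV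
  obtain ⟨ψ, K, s, W, hψ, hW, hs, hpin, hconvF⟩ := hcompF y φ hφ
  have hconv' : ∀ z : (EuclideanSpace ℝ (Fin 3)), Tendsto (fun n => V (φ (ψ n)) (y (φ (ψ n)) + z)) atTop (𝓝 (W s z)) := by
    intro z
    have h1 := hconvF s hs z
    simp only [sub_self, mul_zero, add_zero] at h1
    exact h1
  have hWs : W s = W₀ :=
    funext fun z => tendsto_nhds_unique (hconv' z) ((hconv z).comp hψ.tendsto_atTop)
  subst hWs
  have htT' : Tendsto (fun n => t (σ (φ (ψ n)))) atTop (𝓝 T) :=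
    hdata.2.1.comp ((hσ.comp (hφ.comp hψ)).tendsto_atTop)
  have hgrowthAll : HasLinGrowthAllTime A W := by
    intro τ hτ
    exact FilamentSelection.growthTransferFlow ν A T u (fun n => t (σ (φ (ψ n)))) (fun n => Mb (σ (φ (ψ n))))
      (fun n => y (φ (ψ n))) s τ (W τ) hν hT' (fun n => hdata.2.2.2.1 _) (fun n => (hdata.1 _).2) htT'
      (fun t' ht' => (hsol.contDiff_velocity ht').continuous) hA hs hpin hτ (hconvF τ hτ)
  rcases hdich with hext | ⟨C', η, hC', hη, hcrowd⟩
  · exact not_isExtremalSlice_of_typeIAncientMild hW hs hext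
  · obtain ⟨m, ℓ₀, hℓ₀, hLm⟩ := hL K A C' η s hs hC' hη
    exact hLm W hW hgrowthAll (hcrowd m ℓ₀ hℓ₀)

/-- **The crux from T♭ at member level alone.** [folklore] -/
theorem nearExtremalTransiencePerFlow_of_tightOrCrowdingMembers (hT : TightOrCrowdingMembers) : NearExtremalTransiencePerFlow :=
  nearExtremalTransiencePerFlow_of_tightOrCrowding (tightOrCrowding_of_members hT)

end NearExtremalTransiencePerFlow.MultiscaleCrowding

end Summit.NavierStokesRegularity.NavierStokesRegularity.Theorems

end
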